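/-
Copyright: the b2b-balaban T⁴-continuum CRUX team, row NE7b OWNER lineage `t4-ne7b-p1` (gen 122). Project licence.
-/
import Summits.QuantumFields.BalabanUV.T4Continuum.Spine.NE7b.SupTorusVolumeComparison

/-!
# THE NEXT-SCALE HESSIAN (SCHUR COMPLEMENT `T`) IS VOLUME-INDEPENDENT UP TO `e^{−δs}`: between two tori of coarse periods `s ∣ st` the
# small-volume `T_s` is EXACTLY the deck FOLD of the large-volume `T_{st}` — `T_s(πc ŷ, πc ŷ′) = Σ_{πc ŷ″ = πc ŷ′} T_{st}(ŷ, ŷ″)` (lifting of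
# the block columns + uniqueness) — and the far translates contribute `≤ C·e^{2δρ_{st}(ŷ,ŷ′)}·e^{−δs}` ((134) `schur_entry_le` ⊛ (158)
# `deck_sum_exp_le`); so `|T_{st}(ŷ,ŷ′) − T_s(πc ŷ, πc ŷ′)| ≤ C·e^{2δρ_{st}(ŷ,ŷ′)}·e^{−δs}` on the road's class `V ≥ −λ`, every `d`, every
# mesh (row NE7b, node U5c; the next-scale half of § [NE7bP1-G121-HANDOFF] NEXT (3)(e); (133)∕(134)∕(158) BY NAME; [folklore])

Cell `pub-balaban`, sub-cell `t4`, spine estimate NE7b (`T4WeightBudget.RelWeightBound`; the cell's OWN estimate — NOT PRINTED in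
[Bałaban 1983–89], NOT PROVED).  Crux-route work under `Spine/NE7b/` by the row OWNER (`t4-ne7b-p1` gen 122, file (159)) under FREEZE
(0)'s crux-prover clause; NOTHING of Bałaban's is named as a Lean object, valued or asserted; no `T4Continuum/Support` leaf typed; no `def`,
no notation (the action and `T` DISPLAYED on both tori; covering maps through `π(σ q) = σ q`); zero `sorry`.  Imports (BY NAME): the OWNER's
(158) `…SupTorusVolumeComparison` (`cover_eq`, `bt_cover`, `action_lift`, `deck_sum_exp_le`; through it (134) `schur_entry_le`, (133)
`action_injective`, `action_sum_smul`, (131) `exists_rate`, the torus dictionary `chart_add`, `exists_windowMap_siteOf`, `comp_siteOf_periodic`,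
`natCast_mul_smul_eq`, `siteOf_windowMap`).

WHY (located).  (158) compared the PROPAGATOR of two commensurable volumes; the road iterates through the next-scale Hessian
`W″ = (n+1)^d T⁻¹` ((102)), so the volume dependence of `T` is what the next step sees.  The small block column `ψ^s_{y′}` lifted along
`πf` solves the large equation with the source `𝟙[πc(bt ·) = y′]` (§1 of (158)), which is the deck sum of the large block indicators; so
`ψ^s_{y′}∘πf = Σ_{πc ŷ″ = y′} ψ^{st}_{ŷ″}` by uniqueness, and reading the block mean over a large block `ŷ` (whose lattice block is a period
translate of the small block of `πc ŷ`) gives the FOLDING IDENTITY exactly.  The fold minus its `ŷ′`-term is a sum over translates `≥ s`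
away ((158) `translate_dist`), each entry `≤ m_κ⁻¹e^{2dκ}e^{−κρ}` by (134).

WHAT IS PROVED ([folklore]; small tori `Site d ((n+1)s)` ∕ `Site d s`, large `Site d ((n+1)(st))` ∕ `Site d (st)`; `σ = siteOf`; the block
columns `ψ^s` (potential `V`) and `ψ^{st}` (potential `V∘πf`) DISPLAYED; `T_•(y,y′) = (n+1)^{−d}Σ_z ψ^•_{y′}(σ(chart n (wm y) z))`):
* §1 `blockMean_cover` (the large block mean of `g∘πf` over `ŷ` is the small block mean of `g` over `πc ŷ`), **`schur_fold`** (`a ≥ 0`,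
  `V ≥ −λ`, `λ < min(2,a)`: `T_s(πc ŷ, y′) = Σ_{ŷ″} 𝟙[πc ŷ″ = y′]·T_{st}(ŷ, ŷ″)` for every `ŷ, y′`).
* §2 THE HEADLINE **`nextScale_volume_comparison`**: `a > 0`, `λ < min(2,a)` ⟹ `∃ C δ > 0`: for ALL `n, s, t`, covering maps, `V ≥ −λ`,
  block columns on both tori and all `ŷ, ŷ′`: `|T_{st}(ŷ,ŷ′) − T_s(πc ŷ, πc ŷ′)| ≤ C·e^{2δρ_{st}(ŷ,ŷ′)}·e^{−δs}`.
* §3 toy.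

HONEST (what this is NOT).  `T`, not `T⁻¹` (the fold is an algebra homomorphism on deck-invariant matrices, so `T_s⁻¹` is the fold of
`T_{st}⁻¹` too — not typed here); two commensurable tori, not `ℤ^d`; periodic potentials; constants existential; cubic periods; scalar skeleton
((A3), NC-NE7b-α UNRULED); nothing of Bałaban's.  BY-NAME EFFECT ON THE WALL: NONE.  NE7b NOT PRINTED ∕ NOT PROVED; spine PROVED 0∕9;
rung (B)+1 on a FINITE torus — NOT infinite volume, NOT the mass gap, NOT Clay.  HONEST DEPENDENCY: continuum YM on T⁴ ⇐ BetaPertH ∧ nine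
spine estimates (0∕9 proved); BetaPertH ⇐ (D1) ∧ (D4) ∧ CAP+tail; G-an2-4 gates asym, D1 and NE2∕3∕4.
-/

set_option autoImplicit false

noncomputable section

namespace Summit.QuantumFields.BalabanUV.T4Continuum.NE7b.SupTorusVolumeComparisonNextScale

open Real
open Literature.MathematicalPhysics.QuantumFieldTheory.Balaban1983to89
open B6QGQLower276 (X e blk B side chart mem_B sum_B sum_B_const card_cube blk_chart)
open Beta (Site siteOf windowMap siteOf_windowMap siteOf_add siteOf_sub)
open SupTorusDirichletForm (chart_add)
open SupTorusDirichletFormCoercive (comp_siteOf_periodic)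
open PeriodicSupTorusCarrier (exists_windowMap_siteOf natCast_mul_smul_eq)
open SupTorusHessianCombesThomas (exists_rate)
open SupTorusActionForm (action_injective action_sum_smul)
open SupTorusSchurComplement (schur_entry_le)
open SupTorusVolumeComparison (cover_eq bt_cover action_lift deck_sum_exp_le)

variable {d : ℕ}

/-! ## §1. The folding identity -/

section Fold

variable (n : ℕ) (a : ℝ) (s t : ℕ) [NeZero s] [NeZero t]
  (πf : Site d ((n + 1) * (s * t)) → Site d ((n + 1) * s)) (πc : Site d (s * t) → Site d s)
  (hπf : ∀ q : X d, πf (siteOf d ((n + 1) * (s * t)) q) = siteOf d ((n + 1) * s) q)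
  (hπc : ∀ b : X d, πc (siteOf d (s * t) b) = siteOf d s b)

omit [NeZero t] in
include hπf hπc in
/-- **LARGE BLOCK MEANS OF A LIFT ARE SMALL BLOCK MEANS**: for every `g` on the small fine torus and every large coarse block `ŷ`,
`Σ_z g(πf(σ_{st}(chart n (wm ŷ) z))) = Σ_z g(σ_s(chart n (wm (πc ŷ)) z))` — the two lattice blocks are period translates. [folklore] -/
theorem blockMean_cover [NeZero (s * t)] (g : Site d ((n + 1) * s) → ℝ) (ŷ : Site d (s * t)) :
    ∑ z : Fin d → Fin (n + 1), g (πf (siteOf d ((n + 1) * (s * t)) (chart n (windowMap d (s * t) ŷ) z)))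
      = ∑ z : Fin d → Fin (n + 1), g (siteOf d ((n + 1) * s) (chart n (windowMap d s (πc ŷ)) z)) := by
  have hŷ : πc ŷ = siteOf d s (windowMap d (s * t) ŷ) := by
    conv_lhs => rw [← siteOf_windowMap d (s * t) ŷ]
    exact hπc _
  obtain ⟨m, hm⟩ := exists_windowMap_siteOf s (windowMap d (s * t) ŷ)
  refine Finset.sum_congr rfl fun z _ => ?_
  rw [hπf, hŷ, hm, chart_add]
  exact (comp_siteOf_periodic n s g (chart n (windowMap d (s * t) ŷ) z) m).symm

variable (ha : 0 ≤ a) {lam : ℝ} (hm0 : 0 < min 2 a - lam) (V : Site d ((n + 1) * s) → ℝ) (hV : ∀ x, -lam ≤ V x)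
  (ψs : Site d s → Site d ((n + 1) * s) → ℝ)
  (hψs : ∀ y' x, ((n : ℝ) + 1) ^ 2 * ∑ μ, (2 * ψs y' x - ψs y' (x + siteOf d ((n + 1) * s) (e μ)) - ψs y' (x - siteOf d ((n + 1) * s) (e μ)))
      + a / ((n : ℝ) + 1) ^ d * ∑ q ∈ B n (blk n (windowMap d ((n + 1) * s) x)), ψs y' (siteOf d ((n + 1) * s) q) + V x * ψs y' x
      = if siteOf d s (blk n (windowMap d ((n + 1) * s) x)) = y' then 1 else 0)
  (ψS : Site d (s * t) → Site d ((n + 1) * (s * t)) → ℝ)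
  (hψS : ∀ ŷ' x, ((n : ℝ) + 1) ^ 2 * ∑ μ, (2 * ψS ŷ' x - ψS ŷ' (x + siteOf d ((n + 1) * (s * t)) (e μ))
        - ψS ŷ' (x - siteOf d ((n + 1) * (s * t)) (e μ)))
      + a / ((n : ℝ) + 1) ^ d * ∑ q ∈ B n (blk n (windowMap d ((n + 1) * (s * t)) x)), ψS ŷ' (siteOf d ((n + 1) * (s * t)) q)
      + V (πf x) * ψS ŷ' x
      = if siteOf d (s * t) (blk n (windowMap d ((n + 1) * (s * t)) x)) = ŷ' then 1 else 0)

include hπf hπc ha hm0 hV hψs hψS in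
/-- **THE LIFTED SMALL COLUMN IS THE DECK SUM OF THE LARGE COLUMNS**: `ψ^s_{y′}∘πf = Σ_{ŷ″} 𝟙[πc ŷ″ = y′]·ψ^{st}_{ŷ″}` — both solve the
large equation with the source `𝟙[πc(bt ·) = y′]` ((158) `action_lift`, `bt_cover`; (133) `action_sum_smul`), uniqueness ((133)). [folklore] -/
theorem column_lift_eq (y' : Site d s) :
    (fun x => ψs y' (πf x)) = fun x => ∑ ŷ'' : Site d (s * t), (if πc ŷ'' = y' then (1 : ℝ) else 0) * ψS ŷ'' x := by
  classical
  have hW : ∀ x', -lam ≤ V (πf x') := fun x' => hV _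
  refine action_injective n a (s * t) ha hm0 (fun x' => V (πf x')) hW _ _ fun x => ?_
  rw [action_lift n s t πf hπf a (ψs y') V x, hψs y' (πf x), ← bt_cover n s t πf πc hπf hπc x,
    action_sum_smul n a (s * t) Finset.univ (fun ŷ'' => if πc ŷ'' = y' then (1 : ℝ) else 0) ψS (fun x' => V (πf x')) x]
  simp only [hψS, mul_ite, mul_one, mul_zero, Finset.sum_ite_eq, Finset.mem_univ, if_true]

include hπf hπc ha hm0 hV hψs hψS in
/-- **THE FOLDING IDENTITY**: `T_s(πc ŷ, y′) = Σ_{ŷ″} 𝟙[πc ŷ″ = y′]·T_{st}(ŷ, ŷ″)` for every large block `ŷ` and small block `y′`. [folklore] -/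
theorem schur_fold (ŷ : Site d (s * t)) (y' : Site d s) :
    (((n : ℝ) + 1) ^ d)⁻¹ * ∑ z : Fin d → Fin (n + 1), ψs y' (siteOf d ((n + 1) * s) (chart n (windowMap d s (πc ŷ)) z))
      = ∑ ŷ'' : Site d (s * t), (if πc ŷ'' = y' then (1 : ℝ) else 0)
        * ((((n : ℝ) + 1) ^ d)⁻¹ * ∑ z : Fin d → Fin (n + 1), ψS ŷ'' (siteOf d ((n + 1) * (s * t)) (chart n (windowMap d (s * t) ŷ) z))) := by
  classical
  have heq := column_lift_eq n a s t πf πc hπf hπc ha hm0 V hV ψs hψs ψS hψS y'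
  rw [← blockMean_cover n s t πf πc hπf hπc (ψs y') ŷ]
  have h1 : ∀ z : Fin d → Fin (n + 1), ψs y' (πf (siteOf d ((n + 1) * (s * t)) (chart n (windowMap d (s * t) ŷ) z)))
      = ∑ ŷ'' : Site d (s * t), (if πc ŷ'' = y' then (1 : ℝ) else 0) * ψS ŷ'' (siteOf d ((n + 1) * (s * t)) (chart n (windowMap d (s * t) ŷ) z)) :=
    fun z => congrFun heq _
  rw [Finset.sum_congr rfl fun z _ => h1 z, Finset.sum_comm, Finset.mul_sum]
  exact Finset.sum_congr rfl fun ŷ'' _ => by rw [← Finset.mul_sum]; ring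

end Fold

/-! ## §2. THE END: the Schur complements of two commensurable volumes agree up to `e^{−δs}` -/

/-- **HEADLINE — VOLUME INDEPENDENCE OF THE NEXT-SCALE HESSIAN UP TO `e^{−δs}`, every `d`, every mesh.**  `∃ C δ > 0` (from `(d, a, λ)`) such that
for ALL `n, s, t`, ALL covering maps `πf, πc` reading representatives, ALL small potentials `V ≥ −λ`, ALL block columns `ψ^s` (potential `V`) and
`ψ^{st}` (potential `V∘πf`) and all large blocks `ŷ, ŷ′`: `|T_{st}(ŷ,ŷ′) − T_s(πc ŷ, πc ŷ′)| ≤ C·e^{2δρ_{st}(ŷ,ŷ′)}·e^{−δs}` — §1 `schur_fold`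
at `y′ = πc ŷ′`, the far translates by (134) `schur_entry_le` and (158) `deck_sum_exp_le`.  § [NE7bP1-G121-HANDOFF] NEXT (3)(e), next-scale
half. [folklore] -/
theorem nextScale_volume_comparison (a : ℝ) (ha : 0 < a) {lam : ℝ} (hlam : lam < min 2 a) :
    ∃ C δ : ℝ, 0 < C ∧ 0 < δ ∧ ∀ (n s t : ℕ) [NeZero s] [NeZero t]
      (πf : Site d ((n + 1) * (s * t)) → Site d ((n + 1) * s)) (πc : Site d (s * t) → Site d s),
      (∀ q : X d, πf (siteOf d ((n + 1) * (s * t)) q) = siteOf d ((n + 1) * s) q) →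
      (∀ b : X d, πc (siteOf d (s * t) b) = siteOf d s b) →
      ∀ (V : Site d ((n + 1) * s) → ℝ), (∀ x, -lam ≤ V x) →
      ∀ ψs : Site d s → Site d ((n + 1) * s) → ℝ,
      (∀ y' x, ((n : ℝ) + 1) ^ 2 * ∑ μ, (2 * ψs y' x - ψs y' (x + siteOf d ((n + 1) * s) (e μ)) - ψs y' (x - siteOf d ((n + 1) * s) (e μ)))
        + a / ((n : ℝ) + 1) ^ d * ∑ q ∈ B n (blk n (windowMap d ((n + 1) * s) x)), ψs y' (siteOf d ((n + 1) * s) q) + V x * ψs y' x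
        = if siteOf d s (blk n (windowMap d ((n + 1) * s) x)) = y' then 1 else 0) →
      ∀ ψS : Site d (s * t) → Site d ((n + 1) * (s * t)) → ℝ,
      (∀ ŷ' x, ((n : ℝ) + 1) ^ 2 * ∑ μ, (2 * ψS ŷ' x - ψS ŷ' (x + siteOf d ((n + 1) * (s * t)) (e μ))
          - ψS ŷ' (x - siteOf d ((n + 1) * (s * t)) (e μ)))
        + a / ((n : ℝ) + 1) ^ d * ∑ q ∈ B n (blk n (windowMap d ((n + 1) * (s * t)) x)), ψS ŷ' (siteOf d ((n + 1) * (s * t)) q)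
        + V (πf x) * ψS ŷ' x
        = if siteOf d (s * t) (blk n (windowMap d ((n + 1) * (s * t)) x)) = ŷ' then 1 else 0) →
      ∀ ŷ ŷ' : Site d (s * t),
        |(((n : ℝ) + 1) ^ d)⁻¹ * ∑ z : Fin d → Fin (n + 1), ψS ŷ' (siteOf d ((n + 1) * (s * t)) (chart n (windowMap d (s * t) ŷ) z))
          - (((n : ℝ) + 1) ^ d)⁻¹ * ∑ z : Fin d → Fin (n + 1), ψs (πc ŷ') (siteOf d ((n + 1) * s) (chart n (windowMap d s (πc ŷ)) z))|
          ≤ C * exp (2 * δ * ∑ i, (((ŷ i - ŷ' i).valMinAbs.natAbs : ℕ) : ℝ)) * exp (-(δ * s)) := by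
  classical
  have hdR : (0 : ℝ) ≤ d := Nat.cast_nonneg d
  have hm0 : 0 < min 2 a - lam := by linarith
  obtain ⟨κ, hκ0, hκ1, hκm⟩ := exists_rate (d := d) a ha.le hm0
  have hm : 0 < min 2 a - lam - 2 * d * κ ^ 2 - a * (exp (2 * d * κ) - 1) := by linarith
  set m := min 2 a - lam - 2 * d * κ ^ 2 - a * (exp (2 * d * κ) - 1) with hm_def
  have hminv : 0 ≤ m⁻¹ := inv_nonneg.2 hm.le
  set δ : ℝ := κ / 2 with hδ_def
  have hδ0 : 0 < δ := by positivity
  set K : ℝ := (2 * (1 - exp (-δ))⁻¹) ^ d with hK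
  have hK0 : 0 ≤ K := pow_nonneg (mul_nonneg zero_le_two (inv_nonneg.2 (sub_nonneg.2 (exp_le_one_iff.2 (by linarith))))) d
  refine ⟨m⁻¹ * exp (2 * d * κ) * K + 1, δ, by positivity, hδ0, ?_⟩
  intro n s t _ _ πf πc hπf hπc V hV ψs hψs ψS hψS ŷ ŷ'
  have hW : ∀ x', -lam ≤ V (πf x') := fun x' => hV _
  -- the entries of the large Schur complement decay
  have hT : ∀ ŷ'' : Site d (s * t), |(((n : ℝ) + 1) ^ d)⁻¹ * ∑ z : Fin d → Fin (n + 1), ψS ŷ'' (siteOf d ((n + 1) * (s * t))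
      (chart n (windowMap d (s * t) ŷ) z))| ≤ m⁻¹ * exp (2 * d * κ) * exp (-(κ * ∑ i, (((ŷ i - ŷ'' i).valMinAbs.natAbs : ℕ) : ℝ))) :=
    fun ŷ'' => schur_entry_le n a (s * t) ha.le hκ0.le hκ1 hm (fun x' => V (πf x')) hW ψS hψS ŷ ŷ''
  -- the folding identity at `y′ = πc ŷ′`, minus the `ŷ′` term
  have hfold := schur_fold n a s t πf πc hπf hπc ha.le hm0 V hV ψs hψs ψS hψS ŷ (πc ŷ')
  have hsplit : ∑ ŷ'' : Site d (s * t), (if πc ŷ'' = πc ŷ' then (1 : ℝ) else 0)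
        * ((((n : ℝ) + 1) ^ d)⁻¹ * ∑ z : Fin d → Fin (n + 1), ψS ŷ'' (siteOf d ((n + 1) * (s * t)) (chart n (windowMap d (s * t) ŷ) z)))
      = (((n : ℝ) + 1) ^ d)⁻¹ * ∑ z : Fin d → Fin (n + 1), ψS ŷ' (siteOf d ((n + 1) * (s * t)) (chart n (windowMap d (s * t) ŷ) z))
        + ∑ ŷ'' : Site d (s * t), (if ŷ'' ≠ ŷ' ∧ πc ŷ'' = πc ŷ' then (1 : ℝ) else 0)
          * ((((n : ℝ) + 1) ^ d)⁻¹ * ∑ z : Fin d → Fin (n + 1), ψS ŷ'' (siteOf d ((n + 1) * (s * t)) (chart n (windowMap d (s * t) ŷ) z))) := by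
    rw [← Finset.add_sum_erase Finset.univ _ (Finset.mem_univ ŷ'), if_pos rfl, one_mul,
      ← Finset.add_sum_erase Finset.univ (fun ŷ'' => (if ŷ'' ≠ ŷ' ∧ πc ŷ'' = πc ŷ' then (1 : ℝ) else 0)
        * ((((n : ℝ) + 1) ^ d)⁻¹ * ∑ z : Fin d → Fin (n + 1), ψS ŷ'' (siteOf d ((n + 1) * (s * t)) (chart n (windowMap d (s * t) ŷ) z))))
        (Finset.mem_univ ŷ')]
    simp only [ne_eq, not_true_eq_false, false_and, if_false, zero_mul, zero_add]
    congr 1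
    exact Finset.sum_congr rfl fun ŷ'' hŷ => by rw [Finset.mem_erase] at hŷ; simp only [hŷ.1, not_false_eq_true, true_and]
  have hdiff : (((n : ℝ) + 1) ^ d)⁻¹ * ∑ z : Fin d → Fin (n + 1), ψS ŷ' (siteOf d ((n + 1) * (s * t)) (chart n (windowMap d (s * t) ŷ) z))
        - (((n : ℝ) + 1) ^ d)⁻¹ * ∑ z : Fin d → Fin (n + 1), ψs (πc ŷ') (siteOf d ((n + 1) * s) (chart n (windowMap d s (πc ŷ)) z))
      = -∑ ŷ'' : Site d (s * t), (if ŷ'' ≠ ŷ' ∧ πc ŷ'' = πc ŷ' then (1 : ℝ) else 0)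
          * ((((n : ℝ) + 1) ^ d)⁻¹ * ∑ z : Fin d → Fin (n + 1), ψS ŷ'' (siteOf d ((n + 1) * (s * t)) (chart n (windowMap d (s * t) ŷ) z))) := by
    rw [hfold, hsplit]; ring
  rw [hdiff, abs_neg]
  calc |∑ ŷ'' : Site d (s * t), (if ŷ'' ≠ ŷ' ∧ πc ŷ'' = πc ŷ' then (1 : ℝ) else 0)
          * ((((n : ℝ) + 1) ^ d)⁻¹ * ∑ z : Fin d → Fin (n + 1), ψS ŷ'' (siteOf d ((n + 1) * (s * t)) (chart n (windowMap d (s * t) ŷ) z)))|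
      ≤ ∑ ŷ'' : Site d (s * t), |(if ŷ'' ≠ ŷ' ∧ πc ŷ'' = πc ŷ' then (1 : ℝ) else 0)
          * ((((n : ℝ) + 1) ^ d)⁻¹ * ∑ z : Fin d → Fin (n + 1), ψS ŷ'' (siteOf d ((n + 1) * (s * t)) (chart n (windowMap d (s * t) ŷ) z)))| :=
        Finset.abs_sum_le_sum_abs _ _
    _ ≤ ∑ ŷ'' : Site d (s * t), m⁻¹ * exp (2 * d * κ) * (if ŷ'' ≠ ŷ' ∧ πc ŷ'' = πc ŷ' then
          exp (-(2 * δ * ∑ i, (((ŷ i - ŷ'' i).valMinAbs.natAbs : ℕ) : ℝ))) else 0) := by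
        refine Finset.sum_le_sum fun ŷ'' _ => ?_
        split_ifs with h
        · rw [one_mul, show 2 * δ = κ by rw [hδ_def]; ring]; exact hT ŷ''
        · rw [zero_mul, abs_zero, mul_zero]
    _ = m⁻¹ * exp (2 * d * κ) * ∑ ŷ'' : Site d (s * t), (if ŷ'' ≠ ŷ' ∧ πc ŷ'' = πc ŷ' then
          exp (-(2 * δ * ∑ i, (((ŷ i - ŷ'' i).valMinAbs.natAbs : ℕ) : ℝ))) else 0) := (Finset.mul_sum _ _ _).symm
    _ ≤ m⁻¹ * exp (2 * d * κ) * (exp (2 * δ * ∑ i, (((ŷ i - ŷ' i).valMinAbs.natAbs : ℕ) : ℝ)) * exp (-(δ * s)) * K) :=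
        mul_le_mul_of_nonneg_left (deck_sum_exp_le s t πc hπc hδ0 ŷ' ŷ) (by positivity)
    _ = (m⁻¹ * exp (2 * d * κ) * K) * exp (2 * δ * ∑ i, (((ŷ i - ŷ' i).valMinAbs.natAbs : ℕ) : ℝ)) * exp (-(δ * s)) := by ring
    _ ≤ (m⁻¹ * exp (2 * d * κ) * K + 1) * exp (2 * δ * ∑ i, (((ŷ i - ŷ' i).valMinAbs.natAbs : ℕ) : ℝ)) * exp (-(δ * s)) := by
        have : (0 : ℝ) ≤ exp (2 * δ * ∑ i, (((ŷ i - ŷ' i).valMinAbs.natAbs : ℕ) : ℝ)) * exp (-(δ * s)) := by positivity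
        nlinarith

/-! ## §3. Toy -/

/-- Toy (`d = 0`, `a = 1`, `λ = 0`): the constants exist. -/
example : ∃ C δ : ℝ, 0 < C ∧ 0 < δ :=
  let ⟨C, δ, hC, hδ, _⟩ := nextScale_volume_comparison (d := 0) 1 one_pos (lam := 0) (by norm_num)
  ⟨C, δ, hC, hδ⟩

end Summit.QuantumFields.BalabanUV.T4Continuum.NE7b.SupTorusVolumeComparisonNextScale
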